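import Mathlib
import HarnessLib
import HarnessLib.Audit
import Summits.AtomisticToContinuum.Statement
import Literature.MathematicalPhysics.QuantumManyBody.PeriodicBoseGas
import Summits.AtomisticToContinuum.BoseEinsteinCondensation.Theorems.BECSectorPoincareTwoScaleScatteringLengthFinite
import Summits.AtomisticToContinuum.BoseEinsteinCondensation.Theorems.BECFeynmanVortexAreaBornRepresentativesExist
import Summits.AtomisticToContinuum.BoseEinsteinCondensation.Theorems.BECGroundStateSOSBoundaryTransferWeakModeFreeRewardSplit
import HarnessLib.Audit.Status.Attr

/-!
Route: BECChargeConjugationRP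

# Route BECChargeConjugationRP — charge conjugation is the continuum's half filling — RP anchor at
the C-point of the lattice relativistic Bose gas, dialled through charge sectors to the dilute
corner

It suffices to show X = RelCornerLRO (item Target): UNIFORM CONDENSATION AT THE NON-RELATIVISTIC
SILVER-BLAZE CORNER of the
lattice relativistic Bose gas. Model (lattice units, ħ = 1, mass 1, typed inline over Mathlib): one
complex coordinate Φ_x per site of
the torus (ℤ/nℤ)³, wave functions Ψ(Φ) on ℂ^(n³) with Lebesgue measure, H_c = Σ_x [(c²/2)(−Δ_Φx) +
(c²/2)|Φ_x|²] + Σ_x Σ_i |Φ_(x+eᵢ) − Φ_x|²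
+ ½ Σ_x Σ_y K(x,y)|Φ_x|²|Φ_y|² with K = b² v^per(b(x−y)), b = L/n, L = (N/ρ)^(1/3), restricted to
the CHARGE SECTOR N (Ψ(e^(iθ)Φ) = e^(iNθ)Ψ(Φ)):
for every Born-regime v (range R, height ≤ ε₀/R²) and ρ < ρ₀(v) the ground states have zero-mode
intensity ⟨|Σ_x Φ_x|²⟩ ≥ κ N n³ with κ
uniform in N (large), in even n ≥ n₀(N) and in c ≥ c₀(N,n). Since Φ_x = a_x + b_x† at mass 1,
⟨|ΣΦ|²⟩/n³ → N₀ + 1 as c → ∞: X is BEC of the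
lattice-regularised dilute gas, uniformly in the regularisation. X → conjunct: CornerTransfer (c →
∞, b → 0 at fixed N), BoundaryTransferWeak
(shared, stmt-0827), ScatteringLengthTransfer (shared, stmt-4285) with BornRepresentativesExist and
ScatteringLengthFinite (stmt-0851). The LINE
to X realises card relativistic-silver-blaze-rp-anchor: AnchorLRO (the C-symmetric point Q = 0 of
the same family with an on-site double well —
reflection positive, ordered at weak coupling) → ChargedAnchorLRO (order survives a small charge
density: the Silver-Blaze corner seen from the
C-point) → DialPersistence (mass, interaction-shape and NR legs of the dial at Born-weak coupling).
Lean: `∃ ε₀ : ℝ, 0 < ε₀ ∧ ∀ v : ℝ → ENNReal,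
Literature.MathematicalPhysics.QuantumManyBody.BoseGas.IsRepulsiveFiniteRange v → (∃ R : ℝ, 0 < R ∧
(∀ r, R < r → v r = 0) ∧ ∀ r, v r ≤ ENNReal.ofReal (ε₀ / R ^ 2)) → ∃ ρ₀ : ℝ, 0 < ρ₀ ∧ ∀ ρ : ℝ, 0 < ρ
→ ρ < ρ₀ → ∃ κ : ℝ, 0 < κ ∧ ∀ᶠ N : ℕ in Filter.atTop, ∃ n₀ : ℕ, ∀ (n : ℕ) [NeZero n], Even n → n₀ ≤
n → ∃ c₀ : ℝ, ∀ c : ℝ, c₀ ≤ c → let L :=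
Literature.MathematicalPhysics.QuantumManyBody.BoseGas.sideLength ρ N; let b := L / n; let pos :
(Fin 3 → ZMod n) → EuclideanSpace ℝ (Fin 3) := fun x => WithLp.toLp 2 (fun i => b * ((x i).val :
ℝ)); let U : ((Fin 3 → ZMod n) → ℂ) → ENNReal := fun Φ => ENNReal.ofReal (∑ x, (c ^ 2 / 2 * ‖Φ x‖ ^
2 + ∑ i : Fin 3, ‖Φ (x + Pi.single i 1) - Φ x‖ ^ 2)) + (∑ x, ∑ y, ENNReal.ofReal (b ^ 2) *
Literature.MathematicalPhysics.QuantumManyBody.BoseGas.periodizedPotential v L (pos x - pos y) * (‖Φ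
x‖₊ : ENNReal) ^ 2 * (‖Φ y‖₊ : ENNReal) ^ 2) / 2; let E : (((Fin 3 → ZMod n) → ℂ) → ℂ) → ENNReal :=
fun Ψ => ∫⁻ Φ, ENNReal.ofReal (c ^ 2 / 2) * (∑ x, ((‖fderiv ℝ Ψ Φ (Pi.single x 1)‖₊ : ENNReal) ^ 2 +
(‖fderiv ℝ Ψ Φ (Pi.single x Complex.I)‖₊ : ENNReal) ^ 2)) + U Φ * (‖Ψ Φ‖₊ : ENNReal) ^ 2; let T :
(((Fin 3 → ZMod n) → ℂ) → ℂ) → Prop := fun Ψ => ContDiff ℝ 1 Ψ ∧ ∫⁻ Φ, (‖Ψ Φ‖₊ : ENNReal) ^ 2 = 1 ∧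
∀ (θ : ℝ) (Φ : (Fin 3 → ZMod n) → ℂ), Ψ (fun x => Complex.exp (θ * Complex.I) * Φ x) = Complex.exp
(N * θ * Complex.I) * Ψ Φ; ∃ δ : ENNReal, 0 < δ ∧ ∀ Ψ, T Ψ → E Ψ ≤ (⨅ (Ψ' : ((Fin 3 → ZMod n) → ℂ) →
ℂ) (_ : T Ψ'), E Ψ') + δ → ENNReal.ofReal (κ * N * (n : ℝ) ^ 3) ≤ ∫⁻ Φ, (‖∑ x, Φ x‖₊ : ENNReal) ^ 2
* (‖Ψ Φ‖₊ : ENNReal) ^ 2`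

## Assembly
DECIDING THEOREM `closes : ChargedAnchorLRO → DialPersistence → CornerTransfer →
BoundaryTransferWeak → ScatteringLengthTransfer → BornRepresentativesExist →
ScatteringLengthFinite → BoseEinsteinCondensation` (the sub-problem Statement decl itself;
glue.lean, sorry-free, rc 0 in Sketch.lean — this route re-files
the items of route BECSilverBlazeRP, retired 2026-08-15 by the D-0027 §2.1 audit because its
assembly named the Literature constant instead of the
Statement decl). Pure logic plus `ENNReal.ofReal_toReal`: given w admissible, put a :=
(scatteringLength w).toReal
(finite by ScatteringLengthFinite); CornerTransfer (DialPersistence ChargedAnchorLRO) yields ε₀ and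
periodic BEC for every Born v; BornRepresentativesExist
gives a bounded Born v with scatteringLength v = ofReal a = scatteringLength w; BoundaryTransferWeak
turns its periodic BEC into HasGroundStateBEC v ρ
for small ρ; ScatteringLengthTransfer v w transfers it to w. AnchorLRO is the N = 0 case of
ChargedAnchorLRO and is not a separate hypothesis.

Rationale: WHY THIS LINE. Every thermodynamic-limit proof of interacting BEC sits at a particle–hole symmetric
point of a lattice model because reflection positivity
(RP) dies with the chemical potential (AizenmanEtAl2004 = LSSY2005 Ch. 11, KLS1988PRL; barrier
HalfFillingReflectionPositivity); the card's
observation is that the continuum gas has such a point too — the charge-conjugation-symmetric vacuum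
(Q = 0, "μ = 0") of its relativistic
completion, where the 2-component lattice φ⁴ Hamiltonian is a nearest-neighbour ferromagnet of REAL
position operators, RP through bond planes,
and ordered at arbitrarily weak quartic coupling by the Fröhlich–Simon–Spencer / Dyson–Lieb–Simon
infrared bound taken to T = 0 à la
Kennedy–Lieb–Shastry (FrohlichSimonSpencer1976, DysonLiebSimon1978, KLS1988PRL; anharmonic crystals
and rotors: DriesslerLandauPerez1979,
PasturKhoruzhenko1987, Wojtkiewicz2012, BjornbergUeltschi2022). Imported: finite-density lattice
field theory's dictionary (Silver Blaze =
onset of the dilute gas at μ = m_phys; half filling ↔ C-symmetry;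
doi:10.1103/PhysRevLett.102.131601, arXiv:1206.2954, arXiv:2105.08066),
written CANONICALLY (charge sectors instead of μ, so no complex action enters the statements and no
equivalence of ensembles is needed), and
the large-gap non-relativistic reduction Φ = a + b† (pair modes gapped by 2c²). What no prior route
does: the RP anchor is weakly coupled and
gapless with the target's own Goldstone infrared (BogoliubovPerturbationInfrared is met at the
anchor and tamed there non-perturbatively),
instead of a dense hard-core lattice point (BECFillingMonotone, BECBlockRotorRP) or a Gaussian point
(BECRenormGroup); negatives index empty.

RANKED CRUXES. #0 RelCornerLRO (target) — X as in § Thesis — Born window ε₀; for admissible v with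
range R and v ≤ ε₀/R², density ρ < ρ₀(v): κ > 0 and, for all large N, all large even n and all large
c, every δ-near-minimiser Ψ of the sector-N energy of H_c (pair kernel b²v^per(b·), b =
(N/ρ)^(1/3)/n) has ∫|Σ_x Φ_x|²|Ψ|² ≥ κ N n³ (card item D2's honest form: corner LRO uniform in c and
in the spacing). (why it might fail: Equivalent, up to the finite-N limits of CornerTransfer, to
thermodynamic-limit BEC of the dilute Born-regime gas itself (open since 1947); the only proposed
access is the dial from the C-point, which is engine-poor (see DialPersistence).) [LSSY2005,
Fournais2020, Seiringer2011, doi:10.1103/PhysRevLett.102.131601, arXiv:1206.2954]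
#2 AnchorLRO (crux) — THE C-SYMMETRIC ANCHOR (card item A0; first to staff, in-print technology,
vendor or re-prove): for every c, lam > 0 there is w₀ such that for w ≥ w₀ the ground state of H =
Σ_x [(c²/2)(−Δ_Φx) + lam(|Φ_x|² − w)²] + Σ_x Σ_i |Φ_(x+eᵢ) − Φ_x|² on the even torus (ℤ/nℤ)³ (no
charge constraint: the absolute ground state, which lies in Q = 0) has ⟨|Σ_x Φ_x|²⟩ ≥ M n⁶, M = M(c,
lam, w) > 0, for all large even n (near-minimiser form). Engine: RP through bond planes for the real
operators Re Φ, Im Φ ⇒ Gaussian domination of the Duhamel function ≤ 1/(2E_k); double commutator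
[[Φ̂_k, H], Φ̂_k†] = c²·const ⇒ KLS T = 0 bound ⟨|Φ̂_k|²⟩ ≲ c/√E_k, summable in d = 3 (even d = 2);
sum rule with ⟨|Φ_x|²⟩ ≥ w(1 − o(1)) for deep wells (rotor limit J/U = 4w²/c² ≫ 1). [difficulty: L]
(why it might fail: T = 0 RP/KLS is printed for bounded spins and rotors (KLS1988PRL,
Wojtkiewicz2012), for anharmonic crystals mostly at T > 0 (DriesslerLandauPerez1979): needs Gaussian
domination for unbounded Schrödinger operators on ℝ^(2n³) and ⟨|Φ_x|²⟩ ≥ w(1−o(1)) uniformly in n.)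
[FrohlichSimonSpencer1976, DysonLiebSimon1978, KLS1988PRL, KLS1988JSP, DriesslerLandauPerez1979,
PasturKhoruzhenko1987, Wojtkiewicz2012, BjornbergUeltschi2022]
#3 ChargedAnchorLRO (crux) — THE VACUUM CONDENSATE SURVIVES A SMALL CHARGE DENSITY (card item D1,
μ-leg, in its purest form): same H as AnchorLRO, ground state in the charge sector N (trial states
with Ψ(e^(iθ)Φ) = e^(iNθ)Ψ(Φ)) for every N ≤ ν₀ n³: ⟨|Σ_x Φ_x|²⟩ ≥ M n⁶ with ν₀, M depending on (c,
lam, w) only — uniform in N and n. N = 0 is AnchorLRO (the absolute ground state is U(1)-invariant).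
The Silver-Blaze corner approached from the C-point: the first place where RP is lost and the first
test of any "perturbation relative to an RP point" engine (μ/charge insertions are ∂_τθ-soft; dual
current representations keep positive weights at Q ≠ 0, arXiv:1206.2954, QuitmannTaggi2023). [deps:
AnchorLRO] [difficulty: open-problem] (why it might fail: No RP in a sector Q ≠ 0
(rp_oddCharge_eq_zero), no correlation inequality; charge-insertion expansions around the RP point
and current-space positivity (QuitmannTaggi2023) never yet gave ODLRO off the symmetric point; false
only if infinitesimal charge melts deep-well order.) [AizenmanEtAl2004, LSSY2005, KLS1988PRL,
QuitmannTaggi2023, arXiv:1206.2954, arXiv:2105.08066, Speer1985]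
#4 DialPersistence (crux) — THE DIAL (card item D1, remaining legs): ChargedAnchorLRO →
RelCornerLRO. To be proved by transporting the uniform LRO bound along a path P in (site potential,
charge density ν = N/n³, interaction kernel, c) space that stays inside the mean-field ordered
region at Born-weak coupling: deform the double well lam(|Φ|² − w)² to the mass term (c²/2)|Φ|²
while the charge density carries the condensate (canonical Silver Blaze: in sector N the onset is
automatic), smear the on-site quartic into the kernel b²v^per(b·) of range R/b sites, and let c
grow; the Goldstone sector (one linear mode, 3+1-D marginal logarithms) is the same along P. The
path is deliberately NOT fixed in the type (see Cheapest falsifier); engines: cluster/RG expansion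
relative to the RP point with Ward identities transporting the infrared bound, or analyticity in the
sector density from zero-free regions of Σ_Q z^Q Z_Q. [deps: ChargedAnchorLRO] [difficulty:
open-problem] (why it might fail: P leaves RP for good (sign problem at μ ≠ 0, no Griffiths/Ginibre
once Q ≠ 0); at the corner a/b → ∞ in lattice units, so 'uniformly weak' holds only in the Born
sense; if every P must approach the onset surface to reach ρ → 0 at fixed v, the transported bound
degenerates there.) [LSSY2005, Seiringer2011, FrohlichSimonSpencer1976,
doi:10.1103/PhysRevLett.102.131601, arXiv:1206.2954, arXiv:2105.08066, Benfatto1994]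
#5 CornerTransfer (crux) — NR CORNER ⇒ PERIODIC BEC (card item D2): RelCornerLRO → for some ε₀ > 0
and every admissible Born-regime v: the PeriodicBEC body of stmt-0826 for v (∃ρ₀ ∀ρ<ρ₀ ∃c>0 ∀ᶠN ∃δ:
every δ-near-minimiser of the periodic N-body energy on the torus of side (N/ρ)^(1/3) has
condensateOccupation ≥ cN). Proof plan at FIXED N: (i) c → ∞ — adiabatic elimination of pair modes
(gap 2c²) maps sector-N ground states of H_c onto ground states of the lattice Bose gas with hopping
1 and pair potential K = b²v^per (first-order projection: |Φ_x|² ↦ n_x + 1, Φ̄_xΦ_y ↦ a†_x a_y), and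
⟨|ΣΦ|²⟩/n³ ↦ N₀ + 1; (ii) n → ∞ (b = L/n → 0) — the lattice N-body quadratic form b⁻²[−Δ_lat + K]
Γ-converges to −Δ + v^per on the torus, ground states converge (unique by Perron–Frobenius for
bounded v), N₀ → condensateOccupation; (iii) κ uniform ⇒ c = κ/2 works for all large N;
near-minimiser sets by compactness at fixed N. [deps: RelCornerLRO] [difficulty: L] (why it might
fail: Two limits at fixed N (c → ∞, b → 0) must commute with near-minimiser sets: needs
uniqueness/continuity of the periodic N-body ground state (bounded v only) and O(K²/c²) virtual-pair
control on sector-N ground states; a quantifier slip (δ before c₀) would make the hypothesis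
unusable.) [LSSY2005, Fournais2020, Seiringer2011, LiebSeiringer2002]
#6 BoundaryTransferWeak (crux) — shared verbatim with route BECPeriodicReduction
(stmt-AtomisticToContinuum-0827): for each admissible v, periodic constant-mode BEC at small density
implies Dirichlet ground-state BEC (HasGroundStateBEC v ρ for ρ < ρ₀). [difficulty: L] (why it might
fail: PeriodicBEC(v) is ground-state-only (δ after N): the Dirichlet ground state is a periodic
trial state lying a wall term ≫ δ above E₀^per, interior restrictions are neither periodic nor of
sharp N; BEC is boundary-condition sensitive (Robinson1976); only the ENERGY transfer is in print.)
[LiebSeiringerSolovejYngvason2005, Basti2022, BoccatoSeiringer2023, Junge2026, Robinson1976,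
LauwersVerbeureZagrebnov2003]
#7 ScatteringLengthTransfer (crux) — shared verbatim with route EqualScatteringTransfer
(stmt-AtomisticToContinuum-4285): for admissible v (bounded) and w with equal scattering length,
small-density Dirichlet BEC transfers from v to w — here it carries the Born-regime corner to every
admissible potential, hard cores included. [difficulty: XL] (why it might fail: False iff LSSY's
open question (Ch. 2 after (2.8)) resolves as "hard- and soft-core gases of equal a differ w.r.t.
BEC"; implied by the conjunct, so no cheap refutation, but every proof idea in hand runs through an
N-uniform corrector bound (route EqualScatteringTransfer rank 2).) [LSSY2005, LiebYngvason1998,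
doi:10.1103/physreva.60.5129,
Literature.Barriers.AtomisticToContinuum.EnergyAsymptoticsWithoutCondensation]
#9 BornRepresentativesExist (support) — every scattering length has a Born-regime representative:
for ε > 0 and a ≥ 0 there is a bounded admissible v of some range R with v ≤ ε/R² and
scatteringLength v = a (top hat of height ε/R² on [0,R]: a = R(1 − tanh Y/Y), Y = √(ε/2), so R =
a/(1 − tanh Y/Y); a = 0 ↦ v = 0, scatteringLength_zero), over the tree's odeScatteringLength facts.
[difficulty: M] [LSSY2005, LiebYngvason1998]
#9 ScatteringLengthFinite (support) — shared verbatim with route EqualScatteringTransfer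
(stmt-AtomisticToContinuum-0851): finite range ⇒ scatteringLength v ≠ ⊤ (a ≤ R₀). [difficulty:
provable-now] [LSSY2005]

TWO-LAYER PLAN. Foreseen glued splits (k ≤ 3, depth 1), none filed now: AnchorLRO ⇐
OscGaussianDomination (RP + Trotter for H on L²(ℝ^(2n³))) → KLSZeroTempSumRule
(double commutator c², ⟨|Φ_x|²⟩ ≥ w(1−o(1))) → AnchorLRO; DialPersistence ⇐ MassLeg
(ChargedAnchorLRO → charged LRO with the double well deformed to
(c²/2)|Φ|² at fixed sector density, on-site quartic) → ShapeLeg (on-site → kernel b²v^per(b·), c ≥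
c₀, ν = ρb³ → 0 along b) → DialPersistence;
CornerTransfer ⇐ NRLimit (c → ∞ at fixed N, n) → ContinuumLimit (n → ∞ at fixed N) → CornerTransfer,
the middle object being the lattice Bose gas
of the definition request.

KILL CRITERIA. ¬ChargedAnchorLRO (deep-well order destroyed by an arbitrarily small charge density)
closes the route `refuted:ChargedAnchorLRO` — the C-point would be
isolated and the card's mechanism void. ¬AnchorLRO as typed ⇒ re-type the normalisation (no kill)
unless the witness is disorder at every w for some c.
¬RelCornerLRO for some Born v refutes dilute BEC for that v (kills every BEC route) or exposes a
typing slip (restate). ¬CornerTransfer ⇒ restate the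
order of limits. ¬BoundaryTransferWeak kills every periodic route, not only this one.
¬ScatteringLengthTransfer ⇒ pivot: the route then delivers
the conjunct for Born-regime potentials only (restate the terminal). A mean-field/one-loop
demonstration that every path from the C-point to the
dilute corner must touch the onset surface or a first-order line removes the rationale of
DialPersistence ⇒ close `exhausted` or shrink the thesis
to AnchorLRO + ChargedAnchorLRO (calibration theorems).

NOT DECOMPOSED YET. The path P itself (chosen only after the one-loop phase diagram, see Cheapest
falsifier); the RP/Trotter Gaussian-domination lemma for unbounded
oscillators and the KLS sum-rule constants (children of AnchorLRO); the lattice non-relativistic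
Bose gas as a named object (definition request) and
the two fixed-N limit lemmas (children of CornerTransfer); Lee–Yang in the charge fugacity; positive
temperature; the Dirichlet transfer internals
(route BECPeriodicReduction); the corrector bound behind ScatteringLengthTransfer (route
EqualScatteringTransfer).

CHEAPEST FALSIFIER. (1) Mean-field + one-loop phase diagram of the lattice O(2) model in the (site
potential, charge density) plane at small lam: is there a path from
(double well, ν = 0) to (mass term, ν = ρb³ with Born kernel) along which the condensate density
stays ≥ const > 0 and the distance to the onset
surface stays ≥ δ₀? An afternoon of algebra; the finite-μ numerics exist
(doi:10.1103/PhysRevLett.102.131601 complex Langevin, arXiv:1206.2954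
dual worm, arXiv:2105.08066 tensor RG, all showing the Silver-Blaze plateau and a second-order
onset). (2) v ≡ 0 in RelCornerLRO: the free lattice
gas in sector N has ⟨|ΣΦ|²⟩ = n³(N + 1) + O(1/c²) exactly — checks the order-parameter dictionary
and κ ≤ 1. (3) lam → ∞ in AnchorLRO (rotor limit
U = c²/2w, J = 2w): the printed rotor bounds (Wojtkiewicz2012, KLS1988PRL) must reproduce M ≈ w for
4w²/c² ≫ 1 — a one-page normalisation check.
Not run here: searchd was unavailable (rc 75) during the session and kit was not needed for (2)–(3),
which are pencil checks recorded in NOTES.md.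

NUMBERS. KLS T = 0 infrared bound: ⟨|Φ̂_k|²⟩ ≤ ½(b_k c_k)^(1/2) with Duhamel b_k ≤ 1/(2E_k), E_k =
Σ_i(1 − cos k_i), double commutator c_k = O(c²) (KLS1988PRL
eqs. (3)–(4)); lattice Green constant (2π)⁻³∫d³k/E_k = 0.5055 (Watson) so the T > 0 FSS route needs
βJ ≳ 0.51/⟨|Φ|²⟩, while the T = 0 sum
Σ_k E_k^(−1/2) converges in d ≥ 2. ALSSY threshold λ ≲ 0.960 in d = 3 (LSSY2005 (11.27)).
Dictionary: Φ = a + b† at mass 1, NR hopping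
t = J/(2m) = 1 for J = 2, pair gap 2c², kernel K = b²v^per(b·) ⇒ b⁻²(−Δ_lat + K) discretises −Δ +
v^per; top-hat Born representative
a = R(1 − tanh Y/Y), Y = √(ε/2). Items at open: 10 (target, 6 cruxes of which 2 shared, 2 support of
which 1 shared, assembly) — the own items carry the ids stmt-AtomisticToContinuum-7459…7465 filed by
the retired predecessor BECSilverBlazeRP (same signatures).

DEFINITION REQUESTS. - `RelativisticLatticeBoseGas` (topic
Literature/MathematicalPhysics/QuantumLattice): the sector-N variational energy, ground-state energy
and
  zero-mode intensity of H_c above as named definitions (so that RelCornerLRO / ChargedAnchorLRO /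
AnchorLRO can be restated in one line each),
  plus the lattice non-relativistic Bose gas (hopping 1, pair kernel) as its c → ∞ companion — filed
with `ledger workitem add --kind definition`
  for the Target after open.
- cite fact wanted: ground-state / low-temperature LRO of quantum anharmonic crystals and rotors by
RP + infrared bounds
  (DriesslerLandauPerez1979, PasturKhoruzhenko1987, Wojtkiewicz2012) as a named Literature Prop to
calibrate AnchorLRO against.

Novelty: Searches (2026-08-15): `lit search` / `lit search --source local` ×4 → searchd unavailable (rc 75)
all session; `lit galaxy search --star all
"relativistic Bose gas at finite chemical potential"` (4 rows: lattice-QCD sign-problem numerics);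
`--star pdf "Silver Blaze phenomenon"` (5 rows:
arXiv:2105.08066 tensor-RG of the 3d O(2) model at finite μ, isospin-QCD); `--star all "quantum
anharmonic crystal"` (4: Verbeure's Many-Body Boson
Systems, Albeverio et al. path integrals); `--star pdf --mode bm25` question on rigorous RP/IR
condensation at μ ≠ 0 (12 rows, reviews
cond-mat/0305138, cond-mat/9811393; nothing rigorous); grep of the 34 Theses of the sub (no
relativistic/C-symmetric anchor); the card's two
novelty audits (FSS1976, FILS1978, DLS1978, DriesslerLandauPerez1979, PasturKhoruzhenko1987, AKKR
2009, Aarts 2009, Gattringer–Kloiber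
arXiv:1206.2954, QuitmannTaggi2023, Lees–Taggi 2020/21).
Nearest prior art found: FrohlichSimonSpencer1976 + DysonLiebSimon1978 + KLS1988PRL (the anchor's
engine), DriesslerLandauPerez1979 /
PasturKhoruzhenko1987 / Wojtkiewicz2012 (LRO of quantum anharmonic crystals and rotors — the anchor
essentially in print, never read as an
interacting ground-state condensation theorem for a continuum-field lattice gas),
doi:10.1103/PhysRevLett.102.131601 and arXiv:1206.2954,
arXiv:2105.08066 (finite-μ relativistic Bose gas / Silver Blaze: numerics and sign-free dual
representations, no theorem), AizenmanEtAl2004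
(RP ⇔ half filling).
Delta: the C-symmetric  [refs: 10.1103/PhysRevLett.102.131601, 2105.08066, 1206.2954, doi:10.1103/PhysRevLett.102.131601, FILS1978, DLS1978, DriesslerLandauPerez1979, PasturKhoruzhenko1987, QuitmannTaggi2023, FrohlichSimonSpencer1976, DysonLiebSimon1978, Wojtkiewicz2012, AizenmanEtAl2004]

Barriers (technique_class: reflection-positivity infrared-bound deformation): - technique_class: reflection-positivity infrared-bound deformation
- Literature.Barriers.AtomisticToContinuum.HalfFillingReflectionPositivity: evaded AT THE ANCHOR by
changing model class (RP regained at the charge-conjugation point of the relativistic completion, at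
weak coupling, not by tuning a filling of hard cores); NOT evaded along the dial — ChargedAnchorLRO
and DialPersistence live in sectors Q ≠ 0 where rp_oddCharge_eq_zero forbids RP states; the bet is
continuity of order along a weakly coupled path, with expansions relative to the RP point or
current-space positivity as engines.
- Literature.Barriers.AtomisticToContinuum.BogoliubovPerturbationInfrared: met head-on — the 3+1-D
marginal logarithms are present along all of P including the anchor, where RP controls them
non-perturbatively; the line proposes to transport that control, not to re-derive it from a Gaussian
point (difference from BECRenormGroup / BECInfraredBound).
- Literature.Barriers.AtomisticToContinuum.SymmetryBreakingWithoutCondensate: respected — every item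
is LRO / zero-mode occupation of the two-point function in a fixed charge sector, never a
quasi-average or a symmetry-breaking field.
- Literature.Barriers.AtomisticToContinuum.KineticGapLengthScales: not engaged — no step trades an
energy gap N/L² against length scales; the corner bound is uniform in the box by hypothesis and the
fixed-N limits of CornerTransfer use compactness, not gaps uniform in N.
- Literature.Barriers.AtomisticToContinuum.E

History (route lifecycle, newest last):
- 2026-08-24T23:43:48Z · DORMANT — reconciler: no traction for 7.2 d (last activity item-evidence-added at 2026-08-17T18:55:01Z); parked, not closed — `ledger route dormant route-AtomisticToConti (operator:999:1173153)
- 2026-08-29T03:12:18Z · REACTIVATED — reconciler: reactivated — activity statement-checked at 2026-08-29T01:17:37Z after parking at 2026-08-24T23:43:48Z (operator:999:3245385)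

sub-problem: BoseEinsteinCondensation · status: open · opened planner-plancard-AtomisticToContinuum-BoseEin-d976bffe-0 2026-08-15T13:47:41Z · rev 6 · ledger route-AtomisticToContinuum-BECChargeConjugationRP
GENERATED by the gate from the ledger (D-0016/17). Provers cite these decls: `theorem foo : Summit.AtomisticToContinuum.BoseEinsteinCondensation.Theses.BECChargeConjugationRP.<Decl> := …` in Summits/AtomisticToContinuum/BoseEinsteinCondensation/Theorems/<Name>.lean.
-/

namespace Summit.AtomisticToContinuum.BoseEinsteinCondensation.Theses.BECChargeConjugationRP

open scoped BigOperators Topology Manifold Classical MeasureTheory ProbabilityTheory Matrix InnerProductSpace ComplexConjugate ContinuousMap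
open Filter Set Function TopologicalSpace MeasureTheory

attribute [summit_statement] _root_.BoseEinsteinCondensation

/-- item stmt-AtomisticToContinuum-9043 · target · rank 0 · open · by planner
why it might fail: Equivalent, up to the finite-N limits of CornerTransfer, to thermodynamic-limit BEC of the dilute Born-regime gas itself (open since 1947); the only proposed access is the dial from the C-point, which is engine-poor (see DialPersistence).
sources: LSSY2005, Fournais2020, Seiringer2011, doi:10.1103/PhysRevLett.102.131601, arXiv:1206.2954
[target] X as in § Thesis — Born window ε₀; for admissible v with range R and v ≤ ε₀/R², density ρ <
ρ₀(v): κ > 0 and, for all large N, all large even n and all large c, every δ-near-minimiser Ψ of the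
sector-N energy of H_c (pair kernel b²v^per(b·), b = (N/ρ)^(1/3)/n) has ∫|Σ_x Φ_x|²|Ψ|² ≥ κ N n³
(card item D2's honest form: corner LRO uniform in c and in the spacing). -/
@[route_item "route-AtomisticToContinuum-BECChargeConjugationRP"]
def RelCornerLRO : Prop :=
  ∃ ε₀ : ℝ, 0 < ε₀ ∧ ∀ v : ℝ → ENNReal, Literature.MathematicalPhysics.QuantumManyBody.BoseGas.IsRepulsiveFiniteRange v → (∃ R : ℝ, 0 < R ∧ (∀ r, R < r → v r = 0) ∧ ∀ r, v r ≤ ENNReal.ofReal (ε₀ / R ^ 2)) → ∃ ρ₀ : ℝ, 0 < ρ₀ ∧ ∀ ρ : ℝ, 0 < ρ → ρ < ρ₀ → ∃ κ : ℝ, 0 < κ ∧ ∀ᶠ N : ℕ in Filter.atTop, ∃ n₀ : ℕ, ∀ (n : ℕ) [NeZero n], Even n → n₀ ≤ n → ∃ c₀ : ℝ, ∀ c : ℝ, c₀ ≤ c → let L := Literature.MathematicalPhysics.QuantumManyBody.BoseGas.sideLength ρ N; let b := L / n; let pos : (Fin 3 → ZMod n) → EuclideanSpace ℝ (Fin 3)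 := fun x => WithLp.toLp 2 (fun i => b * ((x i).val : ℝ)); let U : ((Fin 3 → ZMod n) → ℂ) → ENNReal := fun Φ => ENNReal.ofReal (∑ x, (c ^ 2 / 2 * ‖Φ x‖ ^ 2 + ∑ i : Fin 3, ‖Φ (x + Pi.single i 1) - Φ x‖ ^ 2)) + (∑ x, ∑ y, ENNReal.ofReal (b ^ 2) * Literature.MathematicalPhysics.QuantumManyBody.BoseGas.periodizedPotential v L (pos x - pos y) * (‖Φ x‖₊ : ENNReal) ^ 2 * (‖Φ y‖₊ : ENNReal) ^ 2) / 2; let E : (((Fin 3 → ZMod n) → ℂ) → ℂ) → ENNReal := fun Ψ => ∫⁻ Φ, ENNReal.ofReal (c ^ 2 / 2) * (∑ x, ((‖fderiv ℝ Ψ Φ (Pi.single x 1)‖₊ : ENNReal) ^ 2 + (‖fderiv ℝ Ψ Φ (Pi.single x Complex.I)‖₊ : ENNReal) ^ 2)) + U Φ * (‖Ψ Φ‖₊ : ENNReal) ^ 2; let T : (((Fin 3 → ZMod n) → ℂ) → ℂ) → Prop := fun Ψ => ContDiff ℝ 1 Ψ ∧ ∫⁻ Φ, (‖Ψ Φ‖₊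 : ENNReal) ^ 2 = 1 ∧ ∀ (θ : ℝ) (Φ : (Fin 3 → ZMod n) → ℂ), Ψ (fun x => Complex.exp (θ * Complex.I) * Φ x) = Complex.exp (N * θ * Complex.I) * Ψ Φ; ∃ δ : ENNReal, 0 < δ ∧ ∀ Ψ, T Ψ → E Ψ ≤ (⨅ (Ψ' : ((Fin 3 → ZMod n) → ℂ) → ℂ) (_ : T Ψ'), E Ψ') + δ → ENNReal.ofReal (κ * N * (n : ℝ) ^ 3) ≤ ∫⁻ Φ, (‖∑ x, Φ x‖₊ : ENNReal) ^ 2 * (‖Ψ Φ‖₊ : ENNReal) ^ 2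

/-- item stmt-AtomisticToContinuum-9045 · crux · rank 3 · open · by planner
why it might fail: No RP in a sector Q ≠ 0 (rp_oddCharge_eq_zero), no correlation inequality; charge-insertion expansions around the RP point and current-space positivity (QuitmannTaggi2023) never yet gave ODLRO off the symmetric point; false only if infinitesimal charge melts deep-well order.
sources: AizenmanEtAl2004, LSSY2005, KLS1988PRL, QuitmannTaggi2023, arXiv:1206.2954, arXiv:2105.08066
[crux] THE VACUUM CONDENSATE SURVIVES A SMALL CHARGE DENSITY (card item D1, μ-leg, in its purest
form): same H as AnchorLRO, ground state in the charge sector N (trial states with Ψ(e^(iθ)Φ) =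
e^(iNθ)Ψ(Φ)) for every N ≤ ν₀ n³: ⟨|Σ_x Φ_x|²⟩ ≥ M n⁶ with ν₀, M depending on (c, lam, w) only —
uniform in N and n. N = 0 is AnchorLRO (the absolute ground state is U(1)-invariant). The
Silver-Blaze corner approached from the C-point: the first place where RP is lost and the first test
of any "perturbation relative to an RP point" engine (μ/charge insertions are ∂_τθ-soft; dual
current representations keep positive weights at Q ≠ 0, arXiv:1206.2954, QuitmannTaggi2023). [deps:
AnchorLRO] [difficulty: open-problem] -/
@[route_item "route-AtomisticToContinuum-BECChargeConjugationRP", crux]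
def ChargedAnchorLRO : Prop :=
  ∀ (c lam : ℝ), 0 < c → 0 < lam → ∃ w₀ : ℝ, ∀ w : ℝ, w₀ ≤ w → ∃ ν₀ : ℝ, 0 < ν₀ ∧ ∃ M : ℝ, 0 < M ∧ ∃ n₀ : ℕ, ∀ (n : ℕ) [NeZero n], Even n → n₀ ≤ n → ∀ N : ℕ, (N : ℝ) ≤ ν₀ * (n : ℝ) ^ 3 → let E : (((Fin 3 → ZMod n) → ℂ) → ℂ) → ENNReal := fun Ψ => ∫⁻ Φ, ENNReal.ofReal (c ^ 2 / 2) * (∑ x, ((‖fderiv ℝ Ψ Φ (Pi.single x 1)‖₊ : ENNReal) ^ 2 + (‖fderiv ℝ Ψ Φ (Pi.single x Complex.I)‖₊ : ENNReal) ^ 2)) + ENNReal.ofReal (∑ x, (lam * (‖Φ x‖ ^ 2 - w) ^ 2 + ∑ i : Fin 3, ‖Φ (x + Pi.single i 1) - Φ x‖ ^ 2)) * (‖Ψ Φ‖₊ : ENNReal) ^ 2; let T : (((Fin 3 → ZMod n) → ℂ) → ℂ) → Prop := fun Ψ => ContDiff ℝ 1 Ψ ∧ ∫⁻ Φ, (‖Ψ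 Φ‖₊ : ENNReal) ^ 2 = 1 ∧ ∀ (θ : ℝ) (Φ : (Fin 3 → ZMod n) → ℂ), Ψ (fun x => Complex.exp (θ * Complex.I) * Φ x) = Complex.exp (N * θ * Complex.I) * Ψ Φ; ∃ δ : ENNReal, 0 < δ ∧ ∀ Ψ, T Ψ → E Ψ ≤ (⨅ (Ψ' : ((Fin 3 → ZMod n) → ℂ) → ℂ) (_ : T Ψ'), E Ψ') + δ → ENNReal.ofReal (M * (n : ℝ) ^ 6) ≤ ∫⁻ Φ, (‖∑ x, Φ x‖₊ : ENNReal) ^ 2 * (‖Ψ Φ‖₊ : ENNReal) ^ 2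

/-- item stmt-AtomisticToContinuum-9046 · crux · rank 4 · open · by planner
why it might fail: P leaves RP for good (sign problem at μ ≠ 0, no Griffiths/Ginibre once Q ≠ 0); at the corner a/b → ∞ in lattice units, so 'uniformly weak' holds only in the Born sense; if every P must approach the onset surface to reach ρ → 0 at fixed v, the transported bound degenerates there.
sources: LSSY2005, Seiringer2011, FrohlichSimonSpencer1976, doi:10.1103/PhysRevLett.102.131601, arXiv:1206.2954, arXiv:2105.08066
[crux] THE DIAL (card item D1, remaining legs): ChargedAnchorLRO → RelCornerLRO. To be proved by
transporting the uniform LRO bound along a path P in (site potential, charge density ν = N/n³,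
interaction kernel, c) space that stays inside the mean-field ordered region at Born-weak coupling:
deform the double well lam(|Φ|² − w)² to the mass term (c²/2)|Φ|² while the charge density carries
the condensate (canonical Silver Blaze: in sector N the onset is automatic), smear the on-site
quartic into the kernel b²v^per(b·) of range R/b sites, and let c grow; the Goldstone sector (one
linear mode, 3+1-D marginal logarithms) is the same along P. The path is deliberately NOT fixed in
the type (see Cheapest falsifier); engines: cluster/RG expansion relative to the RP point with Ward
identities transporting the infrared bound, or analyticity in the sector density from zero-free
regions of Σ_Q z^Q Z_Q. [deps: ChargedAnchorLRO] [difficulty: open-problem] -/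
@[route_item "route-AtomisticToContinuum-BECChargeConjugationRP", crux]
def DialPersistence : Prop :=
  ChargedAnchorLRO → RelCornerLRO

/-- item stmt-AtomisticToContinuum-9047 · crux · rank 5 · open · by planner
why it might fail: Two limits at fixed N (c → ∞, b → 0) must commute with near-minimiser sets: needs uniqueness/continuity of the periodic N-body ground state (bounded v only) and O(K²/c²) virtual-pair control on sector-N ground states; a quantifier slip (δ before c₀) would make the hypothesis unusable.
sources: LSSY2005, Fournais2020, Seiringer2011, LiebSeiringer2002
[crux] NR CORNER ⇒ PERIODIC BEC (card item D2): RelCornerLRO → for some ε₀ > 0 and every admissible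
Born-regime v: the PeriodicBEC body of stmt-0826 for v (∃ρ₀ ∀ρ<ρ₀ ∃c>0 ∀ᶠN ∃δ: every
δ-near-minimiser of the periodic N-body energy on the torus of side (N/ρ)^(1/3) has
condensateOccupation ≥ cN). Proof plan at FIXED N: (i) c → ∞ — adiabatic elimination of pair modes
(gap 2c²) maps sector-N ground states of H_c onto ground states of the lattice Bose gas with hopping
1 and pair potential K = b²v^per (first-order projection: |Φ_x|² ↦ n_x + 1, Φ̄_xΦ_y ↦ a†_x a_y), and
⟨|ΣΦ|²⟩/n³ ↦ N₀ + 1; (ii) n → ∞ (b = L/n → 0) — the lattice N-body quadratic form b⁻²[−Δ_lat + K]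
Γ-converges to −Δ + v^per on the torus, ground states converge (unique by Perron–Frobenius for
bounded v), N₀ → condensateOccupation; (iii) κ uniform ⇒ c = κ/2 works for all large N;
near-minimiser sets by compactness at fixed N. [deps: RelCornerLRO] [difficulty: L] -/
@[route_item "route-AtomisticToContinuum-BECChargeConjugationRP", crux]
def CornerTransfer : Prop :=
  RelCornerLRO → ∃ ε₀ : ℝ, 0 < ε₀ ∧ ∀ v : ℝ → ENNReal, Literature.MathematicalPhysics.QuantumManyBody.BoseGas.IsRepulsiveFiniteRange v → (∃ R : ℝ, 0 < R ∧ (∀ r, R < r → v r = 0) ∧ ∀ r, v r ≤ ENNReal.ofReal (ε₀ / R ^ 2)) → ∃ ρ₀ : ℝ, 0 < ρ₀ ∧ ∀ ρ : ℝ, 0 < ρ → ρ < ρ₀ → ∃ c : ℝ, 0 < c ∧ ∀ᶠ N : ℕ in Filter.atTop, ∃ δ : ENNReal, 0 < δ ∧ ∀ Ψ : Literature.MathematicalPhysics.QuantumManyBody.BoseGas.PeriodicTrialState N (Literature.MathematicalPhysics.QuantumManyBody.BoseGas.sideLength ρ N), Literature.MathematicalPhysics.QuantumManyBody.BoseGas.periodicEnergy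 v Ψ ≤ Literature.MathematicalPhysics.QuantumManyBody.BoseGas.periodicGroundStateEnergy v N (Literature.MathematicalPhysics.QuantumManyBody.BoseGas.sideLength ρ N) + δ → ENNReal.ofReal (c * N) ≤ Literature.MathematicalPhysics.QuantumManyBody.BoseGas.condensateOccupation N (Literature.MathematicalPhysics.QuantumManyBody.BoseGas.sideLength ρ N) Ψ.ψ

/-- item stmt-AtomisticToContinuum-0827 · crux · rank 6 · SPLIT (gen 1) into ModeFreeRewardChord, ModeFreeSlopeToBEC + glue Summit.AtomisticToContinuum.BoseEinsteinCondensation.ModeFreeReward.boundaryTransferWeak_of_modeFreeReward · direct attempts still welcome (low priority) · by planner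
why it might fail: PeriodicBEC(v) is ground-state-only (δ after N): the Dirichlet ground state is a periodic trial state lying a wall term ≫ δ above E₀^per, interior restrictions are neither periodic nor of sharp N; BEC is boundary-condition sensitive (Robinson1976); only the ENERGY transfer is in print.
sources: LiebSeiringerSolovejYngvason2005, Basti2022, BoccatoSeiringer2023, Junge2026, Robinson1976, LauwersVerbeureZagrebnov2003
[crux] BoundaryTransferWeak (mode-free boundary-condition transfer, per potential): for each
repulsive finite-range v, PeriodicBEC(v) implies ∃ρ₀>0 ∀ρ∈(0,ρ₀) HasGroundStateBEC v ρ (Dirichlet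
ground state, λ_max(γ) ≥ cN via condensateNumber). Not glue: near-minimiser slacks are O(N/L²) while
Dirichlet/periodic energies differ by a boundary term ≫ N/L², so no energy-comparison proof;
expected route: Neumann bracketing of interior sub-boxes (−Δ_Dir ≥ ⊕−Δ_Neu, v ≥ 0) + a mode-free
criterion (λ_max ≥ tr γ²/N). Only the ENERGY analogue is in print (LiebSeiringerSolovejYngvason2005
Ch. 2 after (2.8)). v ≡ 0: hypothesis and conclusion both true. -/
@[route_item "route-AtomisticToContinuum-BECChargeConjugationRP", crux]
def BoundaryTransferWeak : Prop :=
  ∀ v : ℝ → ENNReal, Literature.MathematicalPhysics.QuantumManyBody.BoseGas.IsRepulsiveFiniteRange v → (∃ ρ₀ : ℝ, 0 < ρ₀ ∧ ∀ ρ : ℝ, 0 < ρ → ρ < ρ₀ → ∃ c : ℝ, 0 < c ∧ ∀ᶠ N : ℕ in Filter.atTop, ∃ δ : ENNReal, 0 < δ ∧ ∀ Ψ : Literature.MathematicalPhysics.QuantumManyBody.BoseGas.PeriodicTrialState N (Literature.MathematicalPhysics.QuantumManyBody.BoseGas.sideLength ρ N), Literature.MathematicalPhysics.QuantumManyBody.BoseGas.periodicEnergy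 v Ψ ≤ Literature.MathematicalPhysics.QuantumManyBody.BoseGas.periodicGroundStateEnergy v N (Literature.MathematicalPhysics.QuantumManyBody.BoseGas.sideLength ρ N) + δ → ENNReal.ofReal (c * N) ≤ Literature.MathematicalPhysics.QuantumManyBody.BoseGas.condensateOccupation N (Literature.MathematicalPhysics.QuantumManyBody.BoseGas.sideLength ρ N) Ψ.ψ) → ∃ ρ₀ : ℝ, 0 < ρ₀ ∧ ∀ ρ : ℝ, 0 < ρ → ρ < ρ₀ → Literature.MathematicalPhysics.QuantumManyBody.BoseGas.HasGroundStateBEC v ρ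

-- parent: BoundaryTransferWeak · child (gen 1)
/--     item stmt-AtomisticToContinuum-18443 · crux · rank 601 · open
    parent: BoundaryTransferWeak · by operator
    why it might fail: A first-order jump of the mode-free condensate fraction at reward 0+ in the TD limit (under-condensed Dirichlet GS with condensed competitors o(N) above: the two-state landscape realised by H_N) kills it; needs rewarded energies to o(lam N), below LHY precision, uniformly in N.
    sources: LSSY2005 App. D (D.15)-(D.19) and §1.2, Griffiths1966 §II (convexity in a source field), LauwersVerbeureZagrebnov2003 = arXiv:math-ph/0205037 (BEC with a one-particle gap; gap -> 0 open), GiorginiPitaevskiiStringari1998 = doi:10.1103/PhysRevLett.80.5040 (condensate fluctuations), Summit.AtomisticToContinuum.BoseEinsteinCondensation.Theorems.PeriodicToDirichlet.Negative.not_softUnrewarding_twoState, Theorems/PeriodicToDirichlet/Negative/RewardedFreeGasGapScale.lean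
[crux] ModeFreeRewardChord (piece X1 of the mode-free reward split of BoundaryTransferWeak;
thermodynamic-limit content). Dirichlet box of side L_N = (N/rho)^(1/3); MODE-FREE rewarded infimum
G_N(lam) := inf_Psi [ <Psi,H Psi> + lam (N - lambda_max(gamma_Psi)) ] (lambda_max = maxOccupation; =
inf over normalised modes phi of the ground-state energies of the number-conserving Hamiltonians H +
lam (N - n_phi); concave in lam, G_N(0) = E_0^D). CLAIM: for every repulsive finite-range v, below
some density, for every tau > 0 there is lam_0 > 0 such that eventually in N and for ALL 0 < lam <=
lam_0 the chord slope of G_N from 0 to lam exceeds the chord slope from 0 to lam_0 by at most tau N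
(additive ENNReal form: G(lam) + (lam/lam_0) E_0 <= E_0 + (lam/lam_0) G(lam_0) + lam tau N). By
concavity chord slopes from 0 can only RISE as lam decreases; the claim is that they rise by o(N)
uniformly in N: no first-order jump of the mode-free condensate fraction at reward 0+ in the
thermodynamic limit (the lam -> 0+ / N -> infinity interchange of LSSY App. D in energy currency).
It FAILS for the two-state landscape of Theorems/PeriodicToDirichlet/Negative/SoftUnrewardingSchema
(chord -> N at fixed -/
@[route_item "route-AtomisticToContinuum-BECChargeConjugationRP", crux]
def ModeFreeRewardChord : Prop :=
  ∀ v : ℝ → ENNReal, Literature.MathematicalPhysics.QuantumManyBody.BoseGas.IsRepulsiveFiniteRange v → ∃ ρ₁ : ℝ, 0 < ρ₁ ∧ ∀ ρ : ℝ, 0 < ρ → ρ < ρ₁ → ∀ τ : ℝ, 0 < τ → ∃ lam₀ : ℝ, 0 < lam₀ ∧ ∀ᶠ N : ℕ in Filter.atTop, ∀ lam : ℝ, 0 < lam → lam ≤ lam₀ → (⨅ Ψ : Literature.MathematicalPhysics.QuantumManyBody.BoseGas.TrialState N (Literature.MathematicalPhysics.QuantumManyBody.BoseGas.sideLength ρ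 N), Literature.MathematicalPhysics.QuantumManyBody.BoseGas.energy v Ψ + ENNReal.ofReal lam * ((N : ENNReal) - Literature.MathematicalPhysics.QuantumManyBody.BoseGas.maxOccupation N Ψ.ψ)) + ENNReal.ofReal (lam / lam₀) * Literature.MathematicalPhysics.QuantumManyBody.BoseGas.groundStateEnergy v N (Literature.MathematicalPhysics.QuantumManyBody.BoseGas.sideLength ρ N) ≤ Literature.MathematicalPhysics.QuantumManyBody.BoseGas.groundStateEnergy v N (Literature.MathematicalPhysics.QuantumManyBody.BoseGas.sideLength ρ N) + ENNReal.ofReal (lam / lam₀) * (⨅ Ψ : Literature.MathematicalPhysics.QuantumManyBody.BoseGas.TrialState N (Literature.MathematicalPhysics.QuantumManyBody.BoseGas.sideLength ρ N), Literature.MathematicalPhysics.QuantumManyBody.BoseGas.energy v Ψ + ENNReal.ofReal lam₀ * ((N : ENNReal) - Literature.MathematicalPhysics.QuantumManyBody.BoseGas.maxOccupation N Ψ.ψ)) + ENNReal.ofReal (lam * τ * N)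

-- parent: BoundaryTransferWeak · child (gen 1)
/--     item stmt-AtomisticToContinuum-18444 · crux · rank 602 · open
    parent: BoundaryTransferWeak · by operator
    why it might fail: Degenerate or disconnected Dirichlet ground spaces for exotic admissible v (non-integrable walls inside the range, hard cores): condensateNumber (inf over ground states) and the reward slope (sup) decouple; needs Perron-Frobenius rigidity in the C^1 class (stmt-9072/11786, open for v = ⊤).
    sources: ReedSimonIV1978 XIII.12, XIII.47 (positivity-improving semigroups, unique ground state), LSSY2005 §1.2 (1.17)-(1.19), stmt-AtomisticToContinuum-9072 GroundStateRigidity (BECWallDressingTransfer), stmt-AtomisticToContinuum-11786 HardCoreExtension, Literature/MathematicalPhysics/QuantumManyBody/CondensateOccupationStability.lean, Summit.AtomisticToContinuum.BoseEinsteinCondensation.TorusInTheBox.stub_nearMinimiserTransfer (p106607)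
[crux] ModeFreeSlopeToBEC (piece X2 of the mode-free reward split of BoundaryTransferWeak; fixed-N
rigidity content). For every repulsive finite-range v, below some density, for every 0 < c <= 1,
eventually in N: if E_0^D(N, L_N) < infinity and the mode-free rewarded infimum G_N(lam) = inf_Psi
[<Psi,H Psi> + lam (N - lambda_max(gamma_Psi))] satisfies G_N(lam) <= E_0^D + lam (1 - c) N for all
0 < lam <= lam_1 (some lam_1 > 0, possibly N-dependent), then condensateNumber v N L_N >= (c/2) N.
Mechanism (each step finite-N): the chord hypothesis yields, for every slack eta > 0, Dirichlet
trial states within eta of E_0^D with lambda_max >= (c - o(1)) N (rewarded near-minimisers at lam ->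
0, variational extraction); L^2-rigidity of Dirichlet near-minimisers up to phase
(stmt-AtomisticToContinuum-9072 GroundStateRigidity: compact resolvent, unique positive ground
state, gap at fixed N) and the sqrt(N)-Lipschitz phase-blind seminorm sqrt(lambda_max) (pattern
Literature/.../CondensateOccupationStability.lean, Theorems/...NearMinimiserTransfer.lean, mode-free
since a sup of seminorms is a seminorm) transfer lambda_max >= (c/2) N to EVERY delta-near-minimiser
for some delta > 0, i.e. to conden -/
@[route_item "route-AtomisticToContinuum-BECChargeConjugationRP", crux]
def ModeFreeSlopeToBEC : Prop :=
  ∀ v : ℝ → ENNReal, Literature.MathematicalPhysics.QuantumManyBody.BoseGas.IsRepulsiveFiniteRange v → ∃ ρ₁ : ℝ, 0 < ρ₁ ∧ ∀ ρ : ℝ, 0 < ρ → ρ < ρ₁ → ∀ c : ℝ, 0 < c → c ≤ 1 → ∀ᶠ N : ℕ in Filter.atTop, Literature.MathematicalPhysics.QuantumManyBody.BoseGas.groundStateEnergy v N (Literature.MathematicalPhysics.QuantumManyBody.BoseGas.sideLength ρ N) ≠ ⊤ → (∃ lam₁ : ℝ, 0 < lam₁ ∧ ∀ lam : ℝ, 0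 < lam → lam ≤ lam₁ → (⨅ Ψ : Literature.MathematicalPhysics.QuantumManyBody.BoseGas.TrialState N (Literature.MathematicalPhysics.QuantumManyBody.BoseGas.sideLength ρ N), Literature.MathematicalPhysics.QuantumManyBody.BoseGas.energy v Ψ + ENNReal.ofReal lam * ((N : ENNReal) - Literature.MathematicalPhysics.QuantumManyBody.BoseGas.maxOccupation N Ψ.ψ)) ≤ Literature.MathematicalPhysics.QuantumManyBody.BoseGas.groundStateEnergy v N (Literature.MathematicalPhysics.QuantumManyBody.BoseGas.sideLength ρ N) + ENNReal.ofReal (lam * (1 - c) * N)) → ENNReal.ofReal (c / 2 * N) ≤ Literature.MathematicalPhysics.QuantumManyBody.BoseGas.condensateNumber v N (Literature.MathematicalPhysics.QuantumManyBody.BoseGas.sideLength ρ N)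

/-- glue for the split of `BoundaryTransferWeak`: landed theorem `Summit.AtomisticToContinuum.BoseEinsteinCondensation.ModeFreeReward.boundaryTransferWeak_of_modeFreeReward`. -/
theorem BoundaryTransferWeakGlueBy_holds : ModeFreeRewardChord → ModeFreeSlopeToBEC → BoundaryTransferWeak := _root_.Summit.AtomisticToContinuum.BoseEinsteinCondensation.ModeFreeReward.boundaryTransferWeak_of_modeFreeReward

/-- item stmt-AtomisticToContinuum-9048 · crux · rank 7 · open · by planner
why it might fail: False iff LSSY's open question (Ch. 2 after (2.8)) resolves as "hard- and soft-core gases of equal a differ w.r.t. BEC"; implied by the conjunct, so no cheap refutation, but every proof idea in hand runs through an N-uniform corrector bound (route EqualScatteringTransfer rank 2).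
sources: LSSY2005, LiebYngvason1998, doi:10.1103/physreva.60.5129, Literature.Barriers.AtomisticToContinuum.EnergyAsymptoticsWithoutCondensation
[crux] shared verbatim with route EqualScatteringTransfer (stmt-AtomisticToContinuum-4285): for
admissible v (bounded) and w with equal scattering length, small-density Dirichlet BEC transfers
from v to w — here it carries the Born-regime corner to every admissible potential, hard cores
included. [difficulty: XL] -/
@[route_item "route-AtomisticToContinuum-BECChargeConjugationRP", crux]
def ScatteringLengthTransfer : Prop :=
  ∀ v w : ℝ → ENNReal, Literature.MathematicalPhysics.QuantumManyBody.BoseGas.IsRepulsiveFiniteRange v → Literature.MathematicalPhysics.QuantumManyBody.BoseGas.IsRepulsiveFiniteRange w → (∃ M : NNReal, ∀ r, v r ≤ M) → Literature.MathematicalPhysics.QuantumManyBody.BoseGas.scatteringLength v = Literature.MathematicalPhysics.QuantumManyBody.BoseGas.scatteringLength w → (∃ ρ₀ : ℝ, 0 < ρ₀ ∧ ∀ ρ : ℝ, 0 < ρ → ρ < ρ₀ → Literature.MathematicalPhysics.QuantumManyBody.BoseGas.HasGroundStateBEC v ρ) → ∃ ρ₀ : ℝ, 0 < ρ₀ ∧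 ∀ ρ : ℝ, 0 < ρ → ρ < ρ₀ → Literature.MathematicalPhysics.QuantumManyBody.BoseGas.HasGroundStateBEC w ρ

/-- item stmt-AtomisticToContinuum-9044 · aside · rank 2 · open · by planner
why it might fail: T = 0 RP/KLS is printed for bounded spins and rotors (KLS1988PRL, Wojtkiewicz2012), for anharmonic crystals mostly at T > 0 (DriesslerLandauPerez1979): needs Gaussian domination for unbounded Schrödinger operators on ℝ^(2n³) and ⟨|Φ_x|²⟩ ≥ w(1−o(1)) uniformly in n.
sources: FrohlichSimonSpencer1976, DysonLiebSimon1978, KLS1988PRL, KLS1988JSP, DriesslerLandauPerez1979, PasturKhoruzhenko1987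
[crux] THE C-SYMMETRIC ANCHOR (card item A0; first to staff, in-print technology, vendor or
re-prove): for every c, lam > 0 there is w₀ such that for w ≥ w₀ the ground state of H = Σ_x
[(c²/2)(−Δ_Φx) + lam(|Φ_x|² − w)²] + Σ_x Σ_i |Φ_(x+eᵢ) − Φ_x|² on the even torus (ℤ/nℤ)³ (no charge
constraint: the absolute ground state, which lies in Q = 0) has ⟨|Σ_x Φ_x|²⟩ ≥ M n⁶, M = M(c, lam,
w) > 0, for all large even n (near-minimiser form). Engine: RP through bond planes for the real
operators Re Φ, Im Φ ⇒ Gaussian domination of the Duhamel function ≤ 1/(2E_k); double commutator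
[[Φ̂_k, H], Φ̂_k†] = c²·const ⇒ KLS T = 0 bound ⟨|Φ̂_k|²⟩ ≲ c/√E_k, summable in d = 3 (even d = 2);
sum rule with ⟨|Φ_x|²⟩ ≥ w(1 − o(1)) for deep wells (rotor limit J/U = 4w²/c² ≫ 1). [difficulty: L] -/
@[route_item "route-AtomisticToContinuum-BECChargeConjugationRP"]
def AnchorLRO : Prop :=
  ∀ (c lam : ℝ), 0 < c → 0 < lam → ∃ w₀ : ℝ, ∀ w : ℝ, w₀ ≤ w → ∃ M : ℝ, 0 < M ∧ ∃ n₀ : ℕ, ∀ (n : ℕ) [NeZero n], Even n → n₀ ≤ n → let E : (((Fin 3 → ZMod n) → ℂ) → ℂ) → ENNReal := fun Ψ => ∫⁻ Φ, ENNReal.ofReal (c ^ 2 / 2) * (∑ x, ((‖fderiv ℝ Ψ Φ (Pi.single x 1)‖₊ : ENNReal) ^ 2 + (‖fderiv ℝ Ψ Φ (Pi.single x Complex.I)‖₊ : ENNReal) ^ 2)) + ENNReal.ofReal (∑ x, (lam * (‖Φ x‖ ^ 2 - w) ^ 2 + ∑ i : Fin 3, ‖Φ (x + Pi.single i 1) -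 Φ x‖ ^ 2)) * (‖Ψ Φ‖₊ : ENNReal) ^ 2; let T : (((Fin 3 → ZMod n) → ℂ) → ℂ) → Prop := fun Ψ => ContDiff ℝ 1 Ψ ∧ ∫⁻ Φ, (‖Ψ Φ‖₊ : ENNReal) ^ 2 = 1; ∃ δ : ENNReal, 0 < δ ∧ ∀ Ψ, T Ψ → E Ψ ≤ (⨅ (Ψ' : ((Fin 3 → ZMod n) → ℂ) → ℂ) (_ : T Ψ'), E Ψ') + δ → ENNReal.ofReal (M * (n : ℝ) ^ 6) ≤ ∫⁻ Φ, (‖∑ x, Φ x‖₊ : ENNReal) ^ 2 * (‖Ψ Φ‖₊ : ENNReal) ^ 2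

/-- item stmt-AtomisticToContinuum-9006 · support · rank 9 · closed · proved by Summit.AtomisticToContinuum.BoseEinsteinCondensation.Theorems.scatteringLengthFinite_proof @ a500d4b93471 (prover) · by planner
sources: LSSY2005
[support] (shared verbatim with route EqualScatteringTransfer, stmt-AtomisticToContinuum-0851)
finite range ⇒ scatteringLength v ≠ ⊤ (a ≤ R₀ + ε by the C¹ trial φ = 0 on B_{R₀}, = 1 off B_{R₀+ε};
hard cores included since ⊤·0 = 0). Discharges the `≠ ⊤` hypothesis of the cruxes in the glue.
[difficulty: provable-now] -/
@[route_item "route-AtomisticToContinuum-BECChargeConjugationRP", crux]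
def ScatteringLengthFinite : Prop :=
  ∀ v : ℝ → ENNReal, Literature.MathematicalPhysics.QuantumManyBody.BoseGas.IsRepulsiveFiniteRange v → Literature.MathematicalPhysics.QuantumManyBody.BoseGas.scatteringLength v ≠ ⊤

/-- `ScatteringLengthFinite` holds: proved by `Summit.AtomisticToContinuum.BoseEinsteinCondensation.Theorems.scatteringLengthFinite_proof` @ a500d4b93471. -/
theorem ScatteringLengthFinite_holds : ScatteringLengthFinite := _root_.Summit.AtomisticToContinuum.BoseEinsteinCondensation.Theorems.scatteringLengthFinite_proof

/-- item stmt-AtomisticToContinuum-9049 · support · rank 9 · closed · proved by Summit.AtomisticToContinuum.BoseEinsteinCondensation.Theorems.bornRepresentativesExist_proof (prover) · by planner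
sources: LSSY2005, LiebYngvason1998
[support] every scattering length has a Born-regime representative: for ε > 0 and a ≥ 0 there is a
bounded admissible v of some range R with v ≤ ε/R² and scatteringLength v = a (top hat of height
ε/R² on [0,R]: a = R(1 − tanh Y/Y), Y = √(ε/2), so R = a/(1 − tanh Y/Y); a = 0 ↦ v = 0,
scatteringLength_zero), over the tree's odeScatteringLength facts. [difficulty: M] -/
@[route_item "route-AtomisticToContinuum-BECChargeConjugationRP", crux]
def BornRepresentativesExist : Prop :=
  ∀ ε : ℝ, 0 < ε → ∀ a : ℝ, 0 ≤ a → ∃ v : ℝ → ENNReal, Literature.MathematicalPhysics.QuantumManyBody.BoseGas.IsRepulsiveFiniteRange v ∧ (∃ M : NNReal, ∀ r, v r ≤ M) ∧ (∃ R : ℝ, 0 < R ∧ (∀ r, R < r → v r = 0) ∧ ∀ r, v r ≤ ENNReal.ofReal (ε / R ^ 2)) ∧ Literature.MathematicalPhysics.QuantumManyBody.BoseGas.scatteringLength v = ENNReal.ofReal a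

/-- `BornRepresentativesExist` holds: proved by `Summit.AtomisticToContinuum.BoseEinsteinCondensation.Theorems.bornRepresentativesExist_proof`. -/
theorem BornRepresentativesExist_holds : BornRepresentativesExist := _root_.Summit.AtomisticToContinuum.BoseEinsteinCondensation.Theorems.bornRepresentativesExist_proof

/-- item stmt-AtomisticToContinuum-9050 · assembly · rank 1 · closed · proved by Summit.AtomisticToContinuum.BoseEinsteinCondensation.Theorems.becChargeConjugationRP_assembly_proof (prover) · by planner
sources: LSSY2005, KLS1988PRL
[assembly] ChargedAnchorLRO → DialPersistence → CornerTransfer → BoundaryTransferWeak →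
ScatteringLengthTransfer → BornRepresentativesExist → ScatteringLengthFinite →
BoseEinsteinCondensation (the sub-problem Statement decl `BoseEinsteinCondensation`; identical to
the type of `closes`). -/
@[route_item "route-AtomisticToContinuum-BECChargeConjugationRP"]
def Assembly : Prop :=
  ChargedAnchorLRO → DialPersistence → CornerTransfer → BoundaryTransferWeak → ScatteringLengthTransfer → BornRepresentativesExist → ScatteringLengthFinite → BoseEinsteinCondensation

-- `Assembly` holds: proved by `Summit.AtomisticToContinuum.BoseEinsteinCondensation.Theorems.becChargeConjugationRP_assembly_proof` (its module imports this route file, so no `_holds` link can be stated here).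

/-! D-0027 §2.1 — DECIDING THEOREM (planner-authored via `route open/edit --closes-file`; by planner-rrepair-AtomisticToContinuum-BECCharge-f79582cf-g3-0 2026-08-15T16:49:31Z):
its hypotheses are this route's items and its conclusion the sub-problem Statement (glue_lint), and it elaborates with this file. -/

/-- Route glue (D-0027 §2.1): the deciding theorem. Pure logic plus `ENNReal.ofReal_toReal`:
for an admissible `w` put `a := (scatteringLength w).toReal` (finite range ⇒ `≠ ⊤`,
`ScatteringLengthFinite`); `CornerTransfer (DialPersistence ChargedAnchorLRO)` gives the Born
window `ε₀` and periodic constant-mode BEC for every Born-regime potential; `BornRepresentativesExist`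
supplies a bounded Born-regime `v` with `scatteringLength v = ofReal a = scatteringLength w`;
`BoundaryTransferWeak` turns its periodic BEC into `HasGroundStateBEC v ρ` for small `ρ`, and
`ScatteringLengthTransfer v w` carries it to `w`. `AnchorLRO` is the `N = 0` case of
`ChargedAnchorLRO` and `RelCornerLRO` is the common end/start of `DialPersistence`/`CornerTransfer`;
neither is a separate hypothesis. -/
@[closes "route-AtomisticToContinuum-BECChargeConjugationRP"] theorem closes : ChargedAnchorLRO → DialPersistence → CornerTransfer → BoundaryTransferWeak → ScatteringLengthTransfer → BornRepresentativesExist → ScatteringLengthFinite → BoseEinsteinCondensation := by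
  intro h3 h4 h5 h6 h7 h8 h9 w hw
  obtain ⟨ε₀, hε₀, hcorner⟩ := h5 (h4 h3)
  obtain ⟨v, hv, hvM, hvBorn, hva⟩ := h8 ε₀ hε₀ _
    (ENNReal.toReal_nonneg (a := Literature.MathematicalPhysics.QuantumManyBody.BoseGas.scatteringLength w))
  have hsl : Literature.MathematicalPhysics.QuantumManyBody.BoseGas.scatteringLength v =
      Literature.MathematicalPhysics.QuantumManyBody.BoseGas.scatteringLength w := by
    rw [hva, ENNReal.ofReal_toReal (h9 w hw)]
  exact h7 v w hv hw hvM hsl (h6 v hv (hcorner v hv hvBorn))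

end Summit.AtomisticToContinuum.BoseEinsteinCondensation.Theses.BECChargeConjugationRP
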